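import Summits.Ventures.PercRepro.RankLevelSetLevelNineGXForm
import Summits.Ventures.PercRepro.RankLevelSetCoreNineOfFormGX
import Summits.Ventures.PercRepro.RankLevelSetCoreNineLargeCorankGX
import Summits.Ventures.PercRepro.RankLevelSetLevelEightGX
import Summits.Ventures.PercRepro.S3SixWindow

/-!
# PercRepro — THEOREM C₉ ON THE GIANT-EXACT COUNT: C-025 AT LEVEL `9` FOR EVERY FINITE MATROID AND EVERY `p ≥ 237`
(p2, gen 35; a feeder for S4 — the top of the `q = 9` window, from `292`)

p2 g34's level-`9` quartic chain (RankLevelSetLevelNineQuart, `c025_nine_large_quart'`: `p ≥ 292`) re-assembled on p8 g18's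
GIANT-EXACT count (`S2.ncard_eRk_eq_ncard_le_le_giant_exact`, S2GiantExactCount), exactly as the level-`8` chain of
RankLevelSetLevelEightGX: every cell `(p, d)`, `10 ≤ d ≤ 350`, closes at the UNIFORM base `p ≥ 237` (the 341 polynomial
certificates of RankLevelSetLevelNineGXArith{AA…}, the exact tails of RankLevelSetLevelNineGXTails{A…}, the dispatcher
`gx_form_nine`), and the large-corank regime closes from corank `351` (`largeNine_all_gx`); the row `236` fails at the cells
`(236, 150)` and `(236, 151)` (the `159`-point rank-`8` flats through `σ_m·Π_E`).
* **`c025_core_nine_bounded_corank_gx`** — the `e`-free core at level `9`, corank `10 ≤ d ≤ 350`, rank `p ≥ 237`;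
* **`c025_nine_of_eight_gx_from`** — for every `P ≥ 237`: level `8` for all `p ≥ P` implies level `9` for all `p ≥ P + 1`;
* **`c025_nine_at_two_thirty_seven`** — level `9` at rank `237`, every finite matroid (the per-rank wrapper
  `rls_succ_large_at 8 9 237` on level `8` at `236`, `c025_eight_large_gx'`);
* **`c025_nine_large_gx'`** — UNCONDITIONAL over the tree: level `9` for every `p ≥ 237`; **`c025_nine_large_gx`** the same
  in the literal `C025` body.
Axioms: standard.
-/

open scoped Matroid

namespace PercRepro

namespace ThmN

open Set

variable {α : Type}

/-- **The `e`-free core at level `9`, corank `10 ≤ d ≤ 350`, rank `p ≥ 237`, on the giant-exact count**: the form of the cell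
from `gx_form_nine` through `c025_core_nine_of_form_gx`. -/
theorem c025_core_nine_bounded_corank_gx (M : Matroid α) [M.Finite] (p d : ℕ) (hp : 237 ≤ p) (hd10 : 10 ≤ d)
    (hd350 : d ≤ 350) (hR : M.eRank = (p : ℕ∞)) (hn : M.E.ncard = p + d)
    (hfree : ∀ e ∈ M.E, ∃ A ⊆ M.E \ {e}, e ∉ M.closure A ∧ e ∉ M.closure ((M.E \ {e}) \ A)) :
    RLS M p 9 :=
  c025_core_nine_of_form_gx M p d hd10 hR hn hfree (gx_form_nine d hd10 hd350 p hp (p + d) (by omega))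

/-- **THEOREM C₉ ON THE GIANT-EXACT COUNT, GIVEN LEVEL `8` FROM `P`**: for every `P ≥ 237`, level `8` for all `p ≥ P` implies
level `9` for all `p ≥ P + 1` (the core at corank `10 ≤ d ≤ 350` by `c025_core_nine_bounded_corank_gx`, at corank `≥ 351` by
`c025_core_nine_large_corank_gx`; the coranks `≤ 9` are `U = ∅` or Theorem M). -/
theorem c025_nine_of_eight_gx_from (P : ℕ) (hP : 237 ≤ P)
    (h8 : ∀ (M : Matroid α) [M.Finite] (p : ℕ), P ≤ p → RLS M p 8) :
    ∀ (M : Matroid α) [M.Finite] (p : ℕ), P + 1 ≤ p → RLS M p 9 := by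
  intro M _ p hp
  refine rls_succ_large (α := α) 8 9 P ?_ ?_ ?_ M p hp (by omega)
  · intro M' _ p' hP' _
    exact h8 M' p' hP'
  · intro M' _ p' _ hn _
    rcases Nat.lt_or_ge M'.E.ncard (p' + 9) with h | h
    · exact RLS_of_ncard_lt M' h
    · exact RLS_of_ncard_eq M' (by omega)
  · intro M' _ p' hP' hR hbig _ hfree
    rcases Nat.lt_or_ge M'.E.ncard (p' + 351) with h | h
    · exact c025_core_nine_bounded_corank_gx M' p' (M'.E.ncard - p') (by omega) (by omega) (by omega) hR
        (by omega) hfree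
    · exact c025_core_nine_large_corank_gx M' p' (by omega) hR (by omega) hfree

/-- **Level `9` at rank `237`, every finite matroid**: `rls_succ_large_at 8 9 237` on level `8` at `236`
(`c025_eight_large_gx'`), the coranks `≤ 9` (`U = ∅` or Theorem M) and the core at `237`. -/
theorem c025_nine_at_two_thirty_seven (M : Matroid α) [M.Finite] : RLS M 237 9 := by
  refine rls_succ_large_at (α := α) 8 9 237 (by norm_num)
    (fun M _ => c025_eight_large_gx' M 236 (by norm_num)) ?_ ?_ M
  · -- corank `≤ 9`: `U = ∅` or Theorem M
    intro M _ hn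
    rcases Nat.lt_or_ge M.E.ncard (237 + 9) with h | h
    · exact RLS_of_ncard_lt M h
    · exact RLS_of_ncard_eq M (by omega)
  · -- the core at corank `≥ 10`
    intro M _ hR hbig hfree
    rcases Nat.lt_or_ge M.E.ncard (237 + 351) with h | h
    · exact c025_core_nine_bounded_corank_gx M 237 (M.E.ncard - 237) (le_refl _) (by omega) (by omega) hR
        (by omega) hfree
    · exact c025_core_nine_large_corank_gx M 237 (le_refl _) hR (by omega) hfree

/-- **THEOREM C₉ AT `237`, UNCONDITIONAL OVER THE TREE**: every finite matroid satisfies C-025 at level `9` for every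
`p ≥ 237` — the row `237` by `c025_nine_at_two_thirty_seven`, the rows `≥ 238` through the wrapper at `P = 237` on level `8`
for `p ≥ 126` (`c025_eight_large_gx'`). -/
theorem c025_nine_large_gx' (M : Matroid α) [M.Finite] (p : ℕ) (hp : 237 ≤ p) : RLS M p 9 := by
  rcases Nat.lt_or_ge p 238 with h | h
  · have h237 : p = 237 := by omega
    subst h237
    exact c025_nine_at_two_thirty_seven M
  · exact c025_nine_of_eight_gx_from 237 (by norm_num)
      (fun M' _ p' hp' => c025_eight_large_gx' M' p' (by omega)) M p h

/-- The same in the literal `C025` body: `phiK p 9 · #U(p, 9) ≤ #Y(p, 9)` for every finite matroid and every `p ≥ 237`. -/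
theorem c025_nine_large_gx (M : Matroid α) [M.Finite] (p : ℕ) (hp : 237 ≤ p) :
    phiK p 9 * ({A : Set α | A ⊆ M.E ∧ M.eRk A = (p : ℕ∞) ∧ M.eRk (M.E \ A) = (9 : ℕ∞)}.ncard : ℚ) ≤
      ({A : Set α | A ⊆ M.E ∧ (9 : ℕ∞) < M.eRk A ∧ M.eRk A < (p : ℕ∞)}.ncard : ℚ) :=
  c025_nine_large_gx' M p hp

end ThmN

end PercRepro
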